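import Summits.Ventures.PercRepro.C041TriangleSquare
import Summits.Ventures.PercRepro.C041TriangleStar2Star2

/-!
# THE K₂⁺-TRANSFER OF THE TWO-LEAF MAP (mine-3, gen 67; C-041.md §21 (bg))

With THEOREM (TWO-LEAF STAR × TWO-LEAF STAR) `InCone_thetaTri_star2Star2` in the kernel, bilinearity carries the
two-leaf map `w′ ↦ θ_△(v a * v b, w′)` over `K₂⁺ = cone{1, v s, v s * v t, X(p,q)}` (`InCone_thetaTri_star2_K2plus`):
every star with such a decomposition is settled against a two-leaf star (`InCone_thetaTri_star2_of_K2plus`).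
-/

namespace PercRepro

namespace RelaxedTriangle

open TreeClosure Finset

/-- **THE K₂⁺-TRANSFER OF THE TWO-LEAF MAP**: `θ_△(v a * v b, w′) ∈ cone` for every `w′ ∈ K₂⁺`. -/
theorem InCone_thetaTri_star2_K2plus (a b : ℝ) (ha : 0 ≤ a ∧ a ≤ 1) (hb : 0 ≤ b ∧ b ≤ 1) {n₁ n₂ n₃ : ℕ}
    (l0 : ℝ) (hl0 : 0 ≤ l0)
    (μ s : Fin n₁ → ℝ) (hμ : ∀ i, 0 ≤ μ i) (hs : ∀ i, 0 ≤ s i ∧ s i ≤ 1)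
    (ρ s' t' : Fin n₂ → ℝ) (hρ : ∀ j, 0 ≤ ρ j) (hs' : ∀ j, 0 ≤ s' j ∧ s' j ≤ 1) (ht' : ∀ j, 0 ≤ t' j ∧ t' j ≤ 1)
    (ν : Fin n₃ → ℝ) (p q : Fin n₃ → ℕ) (hν : ∀ k, 0 ≤ ν k) :
    InCone (thetaTri (v a * v b) (l0 • (1 : Vec6) + ∑ i, μ i • v (s i) + ∑ j, ρ j • (v (s' j) * v (t' j))
      + ∑ k, ν k • (v 1 ^ p k * v 0 ^ q k))) := by
  have hw : InCone (v a * v b) := (InCone_v a ha).mul (InCone_v b hb)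
  rw [thetaTri_add_right, thetaTri_add_right, thetaTri_add_right, thetaTri_sum_right, thetaTri_sum_right,
    thetaTri_sum_right, thetaTri_smul_right]
  refine (((InCone.smul _ hl0 ?_).add ?_).add ?_).add ?_
  · have := InCone_thetaTri_any_marks' 0 0 hw
    simpa using this
  · refine InCone_sum fun i => ?_
    rw [thetaTri_smul_right]
    exact (InCone_thetaTri_star2_leaf a b (s i) ha hb (hs i)).smul _ (hμ i)
  · refine InCone_sum fun j => ?_
    rw [thetaTri_smul_right]
    exact (InCone_thetaTri_star2Star2 a b (s' j) (t' j) ha hb (hs' j) (ht' j)).smul _ (hρ j)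
  · refine InCone_sum fun k => ?_
    rw [thetaTri_smul_right]
    exact (InCone_thetaTri_any_marks' (p k) (q k) hw).smul _ (hν k)

/-- `H` at a two-leaf star against a star with a `K₂⁺`-decomposition. -/
theorem InCone_thetaTri_star2_of_K2plus (a b : ℝ) (ha : 0 ≤ a ∧ a ≤ 1) (hb : 0 ≤ b ∧ b ≤ 1) {m : ℕ}
    (d : Fin m → ℝ) {n₁ n₂ n₃ : ℕ} (l0 : ℝ) (hl0 : 0 ≤ l0)
    (μ s : Fin n₁ → ℝ) (hμ : ∀ i, 0 ≤ μ i) (hs : ∀ i, 0 ≤ s i ∧ s i ≤ 1)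
    (ρ s' t' : Fin n₂ → ℝ) (hρ : ∀ j, 0 ≤ ρ j) (hs' : ∀ j, 0 ≤ s' j ∧ s' j ≤ 1) (ht' : ∀ j, 0 ≤ t' j ∧ t' j ≤ 1)
    (ν : Fin n₃ → ℝ) (p q : Fin n₃ → ℕ) (hν : ∀ k, 0 ≤ ν k)
    (hd : V d = l0 • (1 : Vec6) + ∑ i, μ i • v (s i) + ∑ j, ρ j • (v (s' j) * v (t' j))
      + ∑ k, ν k • (v 1 ^ p k * v 0 ^ q k)) :
    InCone (thetaTri (v a * v b) (V d)) := by
  rw [hd]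
  exact InCone_thetaTri_star2_K2plus a b ha hb l0 hl0 μ s hμ hs ρ s' t' hρ hs' ht' ν p q hν

end RelaxedTriangle

end PercRepro
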